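import Mathlib
import Summits.CriticalPhenomena.Ising3DConformalLimit.Theorems.PrecisionLaplacianInverseMFerromagnetDbOfIm
import Summits.CriticalPhenomena.Ising3DConformalLimit.Theorems.PrecisionLaplacianInverseMFerromagnetImLeFive
import HarnessLib

/-!
# Crux `PrecisionLaplacian.InverseMFerromagnet` (stmt-CriticalPhenomena-4798), line `Sketch` —
# stubs `helper_db_of_im_local` (L1) and `helper_db_le_four` (L2)

THEOREM-ONLY helper file (no definitions).  Let `Σ = (⟨σ_pσ_q⟩)_{p,q}` be the spin second-moment
matrix of the zero-field pair ferromagnet `gksExpect univ K C` on `Fin n` (`K ≥ 0`, `|C i| = 2`),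
`x ≠ y`, `κ = ∑_{i : C i = {x,y}} K_i` the total coupling on the pair, `t = tanh κ`, `G = ⟨σ_xσ_y⟩`.
IM = "`(Σ⁻¹)_pq ≤ 0` off the diagonal"; DB♯ = "`(Σ⁻¹)_xy ≤ −t/(1 + t² − 2tG)`".

* `helper_db_of_im_local` (**size-local self-improvement**): IM for ALL pair ferromagnets on
  `n + 1` sites implies DB♯ for all pair ferromagnets on `n` sites.  The proof is that of the
  landed `helper_db_of_im` (sibling `…DbOfIm.lean`), which uses IM only for the once-subdivided
  system on `Fin (n+1)`: move the coupling `κ` of `{x,y}` onto a path `x – w – y` through one fresh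
  site `w = last n` (`cosh 2J = e^{2κ}`); summing out `σ_w` restores the old law (`db_gksSum_old`,
  `Σ` is the principal submatrix of the new `Σ*`), row `w` of `Σ*` is `α(row x' + row y')`
  (`db_gksSum_fresh`, `α = ½ tanh 2J`), one-index elimination gives
  `(Σ⁻¹)_xy = (Σ*⁻¹)_{x'y'} − α²/V` (`db_schur_row`), IM at `(x', y')` in the new system and
  `α²/V = t/(1 + t² − 2tG)` (`db_final_algebra`) finish.
* `helper_db_le_four` (**DB♯ on at most four sites**): `helper_db_of_im_local` fed by the landed
  `helper_im_le_five` (IM on `≤ 5` sites, sibling `…ImLeFive.lean`).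
-/

namespace Summit.CriticalPhenomena.Ising3DConformalLimit.Cruxes.InverseMFerromagnet.PartialCovarianceLadder

open Literature.Probability.LatticeModels Finset Matrix

noncomputable section

/-- **L1 · size-local self-improvement.**  IM for all pair ferromagnets on `n + 1` sites implies
DB♯ for all pair ferromagnets on `n` sites: for every zero-field pair ferromagnet on `Fin n` and
every `x ≠ y` with total coupling `κ = ∑_{i : C i = {x,y}} K_i`, `t = tanh κ`, `G = ⟨σ_xσ_y⟩`,
`(Σ⁻¹)_xy ≤ −t/(1 + t² − 2tG)`.  Proof = that of `helper_db_of_im`: subdivide the bond `{x,y}`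
through ONE fresh site, explicit row of the fresh site, one-index elimination, IM for the new
system (the hypothesis, at size `n + 1` only) and the final algebra. [folklore] -/
theorem helper_db_of_im_local :
    ∀ n : ℕ,
      (∀ (m : ℕ) (K : Fin m → ℝ) (C : Fin m → Finset (Fin (n + 1))), (∀ i, 0 ≤ K i) → (∀ i, (C i).card = 2) →
        ∀ x y : Fin (n + 1), x ≠ y →
          (Matrix.of fun p q : Fin (n + 1) => gksExpect Finset.univ K C (fun ω => spinAt p ω * spinAt q ω))⁻¹ x y ≤ 0) →
      ∀ (m : ℕ) (K : Fin m → ℝ) (C : Fin m → Finset (Fin n)), (∀ i, 0 ≤ K i) → (∀ i, (C i).card = 2) →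
        ∀ x y : Fin n, x ≠ y →
        (Matrix.of fun p q : Fin n => gksExpect Finset.univ K C (fun ω => spinAt p ω * spinAt q ω))⁻¹ x y ≤
          -(Real.tanh (∑ i ∈ Finset.univ.filter (fun i => C i = {x, y}), K i)) /
            (1 + Real.tanh (∑ i ∈ Finset.univ.filter (fun i => C i = {x, y}), K i) ^ 2
              - 2 * Real.tanh (∑ i ∈ Finset.univ.filter (fun i => C i = {x, y}), K i)
                * gksExpect Finset.univ K C (fun ω => spinAt x ω * spinAt y ω)) := by
  intro n hIM m K C hK hC x y hxy
  -- the total coupling `κ ≥ 0` on `{x, y}`; `J ≥ 0` with `cosh 2J = e^{2κ}`; `α = ½ tanh 2J`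
  obtain ⟨κ, hκ⟩ : ∃ κ : ℝ, ∑ i ∈ Finset.univ.filter (fun i => C i = {x, y}), K i = κ := ⟨_, rfl⟩
  have hκ0 : 0 ≤ κ := hκ ▸ Finset.sum_nonneg fun i _ => hK i
  obtain ⟨J, hJ0, hJ⟩ := c4_exists_coupling hκ0
  obtain ⟨α, hα⟩ : ∃ α : ℝ, α = (Real.exp (2 * J) - Real.exp (-(2 * J)))
      / (2 * (Real.exp (2 * J) + Real.exp (-(2 * J)))) := ⟨_, rfl⟩
  rw [hκ]
  -- the once-subdivided system `(Ks, Cs)`: `Fin (n+1)` sites, `Fin (m+2)` bonds, `K ≥ 0`, pairs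
  have hxy' : x.castSucc ≠ y.castSucc := fun h => hxy (Fin.castSucc_injective _ h)
  obtain ⟨Ks, hK1, hK2⟩ : ∃ Ks : Fin (m + 2) → ℝ,
      (∀ i, Ks (Fin.castAdd 2 i) = if C i = {x, y} then 0 else K i) ∧
        ∀ j : Fin 2, Ks (Fin.natAdd m j) = J :=
    ⟨Fin.append (fun i => if C i = {x, y} then 0 else K i) (fun _ => J),
      fun i => Fin.append_left _ _ i, fun j => Fin.append_right _ _ j⟩
  obtain ⟨Cs, hC1, hC20, hC21⟩ : ∃ Cs : Fin (m + 2) → Finset (Fin (n + 1)),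
      (∀ i, Cs (Fin.castAdd 2 i) = (C i).map Fin.castSuccEmb) ∧
        Cs (Fin.natAdd m 0) = {Fin.last n, x.castSucc} ∧
          Cs (Fin.natAdd m 1) = {Fin.last n, y.castSucc} :=
    ⟨Fin.append (fun i => (C i).map Fin.castSuccEmb)
        ![{Fin.last n, x.castSucc}, {Fin.last n, y.castSucc}],
      fun i => Fin.append_left _ _ i, Fin.append_right _ _ 0, Fin.append_right _ _ 1⟩
  have hKs0 : ∀ j, 0 ≤ Ks j := fun j =>
    Fin.addCases (fun i => by rw [hK1]; split_ifs; exacts [le_rfl, hK i])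
      (fun i => by rw [hK2]; exact hJ0) j
  have hCs2 : ∀ j, (Cs j).card = 2 := fun j => by
    refine Fin.addCases (fun i => ?_) (Fin.forall_fin_two.2 ⟨?_, ?_⟩) j
    · rw [hC1, Finset.card_map]; exact hC i
    · rw [hC20]; exact Finset.card_pair (Fin.castSucc_lt_last x).ne'
    · rw [hC21]; exact Finset.card_pair (Fin.castSucc_lt_last y).ne'
  -- its second-moment matrix `A = Σ*`: positive definite, and IM (at size `n + 1`) applies at
  -- the pair `(x', y')`
  obtain ⟨A, hA⟩ : ∃ A : Matrix (Fin (n + 1)) (Fin (n + 1)) ℝ,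
      A = Matrix.of (fun p q : Fin (n + 1) =>
        gksExpect Finset.univ Ks Cs (fun ω => spinAt p ω * spinAt q ω)) := ⟨_, rfl⟩
  have hPD : A.PosDef := pcov_posDef_of_eq hA
  have hS : A⁻¹ x.castSucc y.castSucc ≤ 0 := by
    rw [hA]
    exact hIM (m + 2) Ks Cs hKs0 hCs2 _ _ hxy'
  -- the entries of `A`: unit diagonal, old block `= Σ`, row `w` `= α (row x' + row y')`
  have hdiag : ∀ p, A p p = 1 := fun p => by
    simp only [hA, Matrix.of_apply, spinAt_mul_self, gksExpect]
    exact div_self (gksSum_one_pos _ _ _).ne'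
  have hZ : gksSum Finset.univ Ks Cs (fun _ => (1 : ℝ))
      = 2 * Real.exp κ * gksSum Finset.univ K C (fun _ => 1) :=
    db_gksSum_old hK1 hK2 hC1 hC20 hC21 hxy hκ hJ (fun _ => (1 : ℝ))
  have h2κ : (2 * Real.exp κ) ≠ 0 := by positivity
  have hold : ∀ p q : Fin n, A p.castSucc q.castSucc
      = gksExpect Finset.univ K C (fun σ => spinAt p σ * spinAt q σ) := fun p q => by
    have h2 : gksSum Finset.univ Ks Cs (fun ω => spinAt p.castSucc ω * spinAt q.castSucc ω)
        = 2 * Real.exp κ * gksSum Finset.univ K C (fun σ => spinAt p σ * spinAt q σ) :=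
      db_gksSum_old hK1 hK2 hC1 hC20 hC21 hxy hκ hJ (fun σ => spinAt p σ * spinAt q σ)
    simp only [hA, Matrix.of_apply, gksExpect]
    rw [hZ, h2]
    exact mul_div_mul_left _ _ h2κ
  have hrow : ∀ q : Fin n, A (Fin.last n) q.castSucc
      = α * (A x.castSucc q.castSucc + A y.castSucc q.castSucc) := fun q => by
    have h2 : gksSum Finset.univ Ks Cs (fun ω => spinAt (Fin.last n) ω * spinAt q.castSucc ω)
        = 2 * Real.exp κ * (α * (gksSum Finset.univ K C (fun σ => spinAt x σ * spinAt q σ)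
            + gksSum Finset.univ K C (fun σ => spinAt y σ * spinAt q σ))) :=
      db_gksSum_fresh hK1 hK2 hC1 hC20 hC21 hxy hκ hJ hα (spinAt q)
    have hZ0 : gksSum Finset.univ K C (fun _ => (1 : ℝ)) ≠ 0 := (gksSum_one_pos _ _ _).ne'
    rw [hold, hold, hA, Matrix.of_apply]
    simp only [gksExpect]
    rw [hZ, h2]
    field_simp
  have hsub : A.submatrix Fin.castSucc Fin.castSucc
      = Matrix.of (fun p q : Fin n =>
          gksExpect Finset.univ K C (fun ω => spinAt p ω * spinAt q ω)) := by
    ext p q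
    rw [Matrix.submatrix_apply, Matrix.of_apply, hold]
  -- degree-two row of `w` and one-index elimination, then the algebra
  obtain ⟨-, hent⟩ := db_schur_row A hPD x y hxy α _ hrow (hdiag _) (hdiag _) (hdiag _)
    (hold x y)
  rw [← hsub, hent, db_tanh_eq κ]
  have h2κ' : Real.exp (2 * κ) = Real.exp κ ^ 2 := by rw [sq, ← Real.exp_add, two_mul]
  refine db_final_algebra (Real.exp_pos κ) ?_ (h2κ' ▸ hJ) hα hS
  rw [← Real.exp_add, add_neg_cancel, Real.exp_zero]

/-- **L2 · DB♯ on at most four sites.**  For every zero-field pair ferromagnet on `n ≤ 4` sites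
and every `x ≠ y` with total coupling `κ = ∑_{i : C i = {x,y}} K_i`, `t = tanh κ`,
`G = ⟨σ_xσ_y⟩`: `(Σ⁻¹)_xy ≤ −t/(1 + t² − 2tG)` — `helper_db_of_im_local` fed by the landed
`helper_im_le_five` (IM on `≤ 5` sites) at size `n + 1 ≤ 5`. [folklore] -/
theorem helper_db_le_four :
    ∀ (n m : ℕ) (K : Fin m → ℝ) (C : Fin m → Finset (Fin n)), n ≤ 4 → (∀ i, 0 ≤ K i) → (∀ i, (C i).card = 2) →
      ∀ x y : Fin n, x ≠ y →
        (Matrix.of fun p q : Fin n => gksExpect Finset.univ K C (fun ω => spinAt p ω * spinAt q ω))⁻¹ x y ≤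
          -(Real.tanh (∑ i ∈ Finset.univ.filter (fun i => C i = {x, y}), K i)) /
            (1 + Real.tanh (∑ i ∈ Finset.univ.filter (fun i => C i = {x, y}), K i) ^ 2
              - 2 * Real.tanh (∑ i ∈ Finset.univ.filter (fun i => C i = {x, y}), K i)
                * gksExpect Finset.univ K C (fun ω => spinAt x ω * spinAt y ω)) := by
  intro n m K C hn hK hC x y hxy
  exact helper_db_of_im_local n
    (fun m' K' C' hK' hC' x' y' hxy' => helper_im_le_five (n + 1) m' K' C' (by omega) hK' hC' x' y' hxy')
    m K C hK hC x y hxy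

end

end Summit.CriticalPhenomena.Ising3DConformalLimit.Cruxes.InverseMFerromagnet.PartialCovarianceLadder
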